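import Literature.Barriers.BirchSwinnertonDyer.PAdicFunctionalEquationParity
import Literature.NumberTheory.EllipticCurves.PAdicLFunctionInvolutionProofs
import Literature.NumberTheory.EllipticCurves.PAdicLFunctionFrickeSymmetryProofs
import Literature.NumberTheory.EllipticCurves.PlusMinusPAdicLFunction
import HarnessLib

/-!
# The finite-level functional equation of the Mazur–Tate elements (any `p`, `p`-integral symbols)
# — proofs only

A *proofs* companion (theorems only; no definition, no named fact) of `PlusMinusPAdicLFunction`
(`mazurTateElement`, `IsCongrModOmega`, `cyclotomicOmega`), `Sprung2017/SharpFlatPAdicLFunction`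
(`IsSprungPair`) and `Literature.Barriers.BirchSwinnertonDyer.PAdicFunctionalEquationParity` (the involution
`ι = T^ι = (1+T)⁻¹ − 1`, `invOnePlusSubOne`). It is the general-`p` twin, WITHOUT the doubling, of §1, §2,
§4 of `PAdicFunctionalEquationSharpFlatTwoProofs` (`exists_two_mul_mazurTateElement_fe`), under the
hypothesis that the plus symbols `[a/p^k]⁺_f` are `p`-INTEGRAL (at an odd good prime with
`a_p ≢ 1 (mod p)`: `Sprung2017.norm_ratPlusSymbol_div_pow_le_one_of_not_dvd`; at `a_p = 0`:
`norm_ratPlusSymbol_div_pow_le_one`).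

## Main results (in `Λ = ℤ_p⟦T⟧`, `ω_n = (1+T)^{pⁿ} − 1`, `P = 1 + T`, `E = 1 + ι = P⁻¹`)

* `subst_invOnePlusSubOne_one_add_X_pow_sub_one` — `ι(ω_n) = −E^{pⁿ}·ω_n` (the ideal `(ω_n)` is
  `ι`-stable); `iwasawaToPowerSeries_subst_invOnePlusSubOne` — `Λ ↪ ℚ_p⟦T⟧` commutes with `ι`.
* `exists_mazurTateElement_fe_integral` — **Mazur–Tate–Teitelbaum §I.17 at finite level**: for `f` with
  `p`-integral plus symbols and `w_N f = −σ f` (`σ = ±1`), and `N ≡ η_N γ^{c_n}` modulo `p^{n+e₀}`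
  (`c_n ∈ [0, pⁿ)` the residue of a `p`-adic exponent `c`), the Mazur–Tate element `θ_n` has an integral
  lift `Θ ∈ Λ` with `Θ(T^ι) − σ (1+T)^{c_n} Θ(T) ∈ ω_n Λ`.

Sequel (`Sprung2017/SharpFlatCombinationFunctionalEquationProofs`): descent of Sprung's congruences to `Λ`
and the transport `Y_n(T^ι) − σ(1+T)^c Y_n ∈ ω_nΛ` for `Y_n = u_n L♯ + v_n L♭`, the finite-level input of
the functional equation of the trace coordinates `(L♯, L♭)·ℒ`. HONEST FRAMING: elementary algebra in `Λ`
plus the tree's Fricke symmetry of modular symbols; BSD is not proved by any of this.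

## References

* B. Mazur, J. Tate, J. Teitelbaum, *On `p`-adic analogues of the conjectures of Birch and
  Swinnerton-Dyer*, Invent. Math. 84 (1986), §I.13 (modular elements), §I.17 (functional equation:
  the involution `a ↦ −1/(Na)` and `x ↦ ⟨N⟩⁻¹x⁻¹`). [MazurTateTeitelbaum1986Invent]
* R. Pollack, *On the `p`-adic `L`-function of a modular form at a supersingular prime*, Duke Math. J.
  118 (2003), Def. 6.15 (the modular element `θ_n`), Thm. 6.17 (`ω_n`). [Pollack2003]
* R. Greenberg, *Iwasawa theory for elliptic curves*, LNM 1716 (1999), §1 (`T^ι = (1+T)⁻¹ − 1`,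
  `L_p(E/ℚ, 2−s) = w_E⟨N_E⟩^{s−1}L_p(E/ℚ, s)`). [GreenbergLNM1716]
-/

noncomputable section

open scoped MatrixGroups ModularForm

open CongruenceSubgroup PowerSeries Literature.NumberTheory.EllipticCurves.ModularForms
  Literature.Barriers.BirchSwinnertonDyer

namespace Literature.NumberTheory.EllipticCurves

/-! ## §1. The involution `ι` on `Λ` and on `ℚ_p⟦T⟧`: `E = 1 + ι = (1+T)⁻¹`, `ι(ω_n) = −E^{pⁿ}ω_n` -/

section Iota

variable {R : Type*} [CommRing R]

-- adapted from Literature/Barriers/BirchSwinnertonDyer/PAdicFunctionalEquationSharpFlatTwoProofs.lean §2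
/-- `(1 + T)·E = 1`, `E = 1 + ι`; private plumbing. [folklore] -/
private theorem one_add_X_mul_E : (1 + X : R⟦X⟧) * (invOnePlusSubOne + 1) = 1 :=
  one_add_X_mul_invOnePlusSubOne_add_one

/-- `(1+T)^k · E^k = 1`; private plumbing. [folklore] -/
private theorem one_add_X_pow_mul_E_pow (k : ℕ) :
    (1 + X : R⟦X⟧) ^ k * (invOnePlusSubOne + 1) ^ k = 1 := by
  rw [← mul_pow, one_add_X_mul_E, one_pow]

/-- `ι(1 + T) = E`; private plumbing. [folklore] -/
private theorem subst_invOnePlusSubOne_one_add_X :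
    (1 + X : R⟦X⟧).subst (invOnePlusSubOne : R⟦X⟧) = invOnePlusSubOne + 1 := by
  have hι := hasSubst_invOnePlusSubOne (R := R)
  rw [subst_add hι, subst_X hι, ← coe_substAlgHom hι, map_one, add_comm]

/-- `ι((1+T)^k) = E^k`; private plumbing. [folklore] -/
private theorem subst_invOnePlusSubOne_one_add_X_pow (k : ℕ) :
    ((1 + X : R⟦X⟧) ^ k).subst (invOnePlusSubOne : R⟦X⟧) = (invOnePlusSubOne + 1) ^ k := by
  rw [subst_pow hasSubst_invOnePlusSubOne, subst_invOnePlusSubOne_one_add_X]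

/-- **`ι(ω_n) = −E^{q}·ω_n`** for `ω = (1+T)^{q} − 1`: the ideal `(ω_n)` is `ι`-stable.
[cite: MazurTateTeitelbaum1986Invent, §I.17] -/
theorem subst_invOnePlusSubOne_one_add_X_pow_sub_one (q : ℕ) :
    ((1 + X : R⟦X⟧) ^ q - 1).subst (invOnePlusSubOne : R⟦X⟧) =
      -(invOnePlusSubOne + 1) ^ q * ((1 + X : R⟦X⟧) ^ q - 1) := by
  have hι := hasSubst_invOnePlusSubOne (R := R)
  rw [subst_sub hι, subst_invOnePlusSubOne_one_add_X_pow, ← coe_substAlgHom hι, map_one]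
  linear_combination (one_add_X_pow_mul_E_pow (R := R) q)

/-- `ι` has integer coefficients: it is fixed by any coefficient map; private plumbing. [folklore] -/
private theorem map_invOnePlusSubOne {S : Type*} [CommRing S] (φ : R →+* S) :
    PowerSeries.map φ (invOnePlusSubOne : R⟦X⟧) = invOnePlusSubOne := by
  ext n
  simp only [coeff_map, coeff_invOnePlusSubOne]
  split_ifs <;> simp

/-- `ι_Λ ∘ S = S ∘ ι_Λ`: the embedding `Λ ↪ ℚ_p⟦T⟧` commutes with `g ↦ g(T^ι)`.
[cite: GreenbergLNM1716, §1 (the involution T ↦ (1+T)⁻¹ − 1)] -/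
theorem iwasawaToPowerSeries_subst_invOnePlusSubOne {p : ℕ} [Fact p.Prime] (g : IwasawaAlgebra p) :
    iwasawaToPowerSeries p (g.subst (invOnePlusSubOne : ℤ_[p]⟦X⟧)) =
      (iwasawaToPowerSeries p g).subst (invOnePlusSubOne : ℚ_[p]⟦X⟧) := by
  have h := map_subst (hasSubst_invOnePlusSubOne (R := ℤ_[p])) (h := algebraMap ℤ_[p] ℚ_[p]) g
  have hι : MvPowerSeries.map (algebraMap ℤ_[p] ℚ_[p]) (invOnePlusSubOne : ℤ_[p]⟦X⟧) =
      (invOnePlusSubOne : ℚ_[p]⟦X⟧) := map_invOnePlusSubOne _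
  rw [hι] at h
  exact h

/-- `ω_n = (1+T)^{pⁿ} − 1` as a power series over `ℤ_p`. [cite: Pollack2003, Thm. 6.17 (ω_n = (1+T)^{p^n} − 1)] -/
theorem coe_map_cyclotomicOmega {p : ℕ} [Fact p.Prime] (n : ℕ) :
    (((cyclotomicOmega p n).map (Int.castRingHom ℤ_[p]) : Polynomial ℤ_[p]) : ℤ_[p]⟦X⟧) =
      (1 + X : ℤ_[p]⟦X⟧) ^ (p ^ n) - 1 := by
  simp only [cyclotomicOmega, Polynomial.map_sub, Polynomial.map_pow, Polynomial.map_add,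
    Polynomial.map_X, Polynomial.map_one, Polynomial.coe_sub, Polynomial.coe_pow,
    Polynomial.coe_add, Polynomial.coe_X, Polynomial.coe_one, add_comm]

end Iota

/-! ## §2. The finite-level functional equation of `θ_n` (integral symbols) -/

section FiniteLevel

/-- Coercion `R[T] → R⟦T⟧` of a finite sum; private plumbing. [folklore] -/
private theorem coe_polynomial_sum {R : Type*} [CommSemiring R] {ι : Type*} (t : Finset ι)
    (q : ι → Polynomial R) :
    (((∑ i ∈ t, q i : Polynomial R)) : R⟦X⟧) = ∑ i ∈ t, ((q i : Polynomial R) : R⟦X⟧) :=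
  map_sum (Polynomial.coeToPowerSeries.ringHom (R := R)) q t

variable {N : ℕ} [NeZero N] {f : CuspForm (Gamma0 N) 2} {p : ℕ} [Fact p.Prime]

omit [NeZero N] in
/-- The Mazur–Tate element, mapped to `ℚ_p⟦T⟧`, as its class sum; private plumbing.
[folklore] -/
private theorem coe_map_mazurTateElement (n : ℕ) :
    ((((mazurTateElement f p n).map (algebraMap ℚ ℚ_[p])) : Polynomial ℚ_[p]) : ℚ_[p]⟦X⟧) =
      ∑ᶠ ξ : rootsOfUnity (torsionOrder p) ℤ_[p], ∑ s : ZMod (p ^ n),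
        PowerSeries.C (((ratPlusSymbol f
          (((PadicInt.toZModPow (n + cyclotomicExponent p) ((ξ : ℤ_[p]ˣ) : ℤ_[p]) *
              (cyclotomicGenerator p : ZMod (p ^ (n + cyclotomicExponent p))) ^ s.val).val : ℚ) /
            (p : ℚ) ^ (n + cyclotomicExponent p)) : ℚ) : ℚ_[p])) *
          (1 + X : ℚ_[p]⟦X⟧) ^ s.val := by
  classical
  haveI := neZero_torsionOrder p
  haveI : Fintype (rootsOfUnity (torsionOrder p) ℤ_[p]) := Fintype.ofFinite _
  rw [mazurTateElement, finsum_eq_sum_of_fintype, finsum_eq_sum_of_fintype, Polynomial.map_sum,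
    coe_polynomial_sum]
  refine Finset.sum_congr rfl fun ξ _ ↦ ?_
  rw [Polynomial.map_sum, coe_polynomial_sum]
  refine Finset.sum_congr rfl fun s _ ↦ ?_
  rw [Polynomial.map_mul, Polynomial.map_pow, Polynomial.map_add, Polynomial.map_X,
    Polynomial.map_one, Polynomial.map_C, Polynomial.coe_mul, Polynomial.coe_pow,
    Polynomial.coe_add, Polynomial.coe_X, Polynomial.coe_one, Polynomial.coe_C, eq_ratCast,
    add_comm (X : ℚ_[p]⟦X⟧) 1]

/-- **The finite-level functional equation of `θ_n`, integral form (Mazur–Tate–Teitelbaum §I.17 at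
finite level; any prime `p`).** Let `f ∈ S₂(Γ₀(N))` have `p`-INTEGRAL plus symbols
`‖[a/p^k]⁺_f‖_p ≤ 1`, Fricke sign `w_N f = −σ f` (`σ = ±1`), and let `N ≡ η_N · γ^{c_n}` modulo
`p^{n+e₀}` with `c_n ∈ [0, pⁿ)` the residue of a `p`-adic exponent `c` (`exists_teichmuller_exponent_natCast`).
Then the Mazur–Tate element `θ_n` has an INTEGRAL lift `Θ ∈ Λ = ℤ_p⟦T⟧` (`ι_Λ Θ = θ_n`) with
`Θ(T^ι) − σ·(1+T)^{c_n}·Θ(T) ∈ ω_n · Λ`.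
Proof: the involution `u ↦ −1/(Nu)` of `(ℤ/p^{n+e₀})^×` (`finsum_sum_classes_eq_mul_of_symmetry`) with the
Fricke symmetry of the symbols `[u/p^{n+e₀}]⁺ = σ·[u'/p^{n+e₀}]⁺` (`IsFrickeEigen.normalizedPlusSymbol_div_eq_mul`),
then term by term `(1+T)^{(−c_n−s) mod pⁿ + c_n} − (1+T)^{−s} = (1+T)^{−s}((1+T)^{pⁿk} − 1) ∈ ω_n Λ`.
[cite: MazurTateTeitelbaum1986Invent, §I.17] -/
theorem exists_mazurTateElement_fe_integral
    (hint : ∀ a k : ℕ, ‖((ratPlusSymbol f ((a : ℚ) / (p : ℚ) ^ k) : ℚ) : ℚ_[p])‖ ≤ 1)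
    {σ : ℤ} (hσ : σ ^ 2 = 1) (hW : IsFrickeEigen N f (-(σ : ℂ))) (n : ℕ)
    {ηN : rootsOfUnity (torsionOrder p) ℤ_[p]} {c : ℤ_[p]}
    (hc : PadicInt.toZModPow (n + cyclotomicExponent p) ((ηN : ℤ_[p]ˣ) : ℤ_[p]) *
      (cyclotomicGenerator p : ZMod (p ^ (n + cyclotomicExponent p))) ^
        (PadicInt.toZModPow n c).val = (N : ZMod (p ^ (n + cyclotomicExponent p)))) :
    ∃ Θ r : IwasawaAlgebra p,
      iwasawaToPowerSeries p Θ =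
          (((mazurTateElement f p n).map (algebraMap ℚ ℚ_[p]) : Polynomial ℚ_[p]) : ℚ_[p]⟦X⟧) ∧
        Θ.subst (invOnePlusSubOne : ℤ_[p]⟦X⟧) -
            (σ : IwasawaAlgebra p) * (1 + X : ℤ_[p]⟦X⟧) ^ (PadicInt.toZModPow n c).val * Θ =
          (((cyclotomicOmega p n).map (Int.castRingHom ℤ_[p]) : Polynomial ℤ_[p]) : ℤ_[p]⟦X⟧) * r := by
  classical
  have hp : p.Prime := Fact.out
  haveI := neZero_torsionOrder p
  haveI : Fintype (rootsOfUnity (torsionOrder p) ℤ_[p]) := Fintype.ofFinite _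
  haveI : NeZero (p ^ n) := ⟨pow_ne_zero _ hp.ne_zero⟩
  haveI : NeZero (p ^ (n + cyclotomicExponent p)) := ⟨pow_ne_zero _ hp.ne_zero⟩
  have hιΛ := hasSubst_invOnePlusSubOne (R := ℤ_[p])
  -- notation (all classes at level `p^{n+e₀}`)
  set sN : ZMod (p ^ n) := PadicInt.toZModPow n c with hsN
  set P : IwasawaAlgebra p := (1 + X : ℤ_[p]⟦X⟧) with hP
  set E : IwasawaAlgebra p := (invOnePlusSubOne : ℤ_[p]⟦X⟧) + 1 with hE
  -- the integral weights
  have hz : ∀ u : ZMod (p ^ (n + cyclotomicExponent p)), ∃ z : ℤ_[p], (z : ℚ_[p]) =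
      ((ratPlusSymbol f ((u.val : ℚ) / (p : ℚ) ^ (n + cyclotomicExponent p)) : ℚ) : ℚ_[p]) :=
    fun u ↦ ⟨⟨_, hint u.val _⟩, rfl⟩
  choose z hz using hz
  -- their Fricke symmetry
  have hzsym : ∀ u u' : ZMod (p ^ (n + cyclotomicExponent p)),
      (N : ZMod (p ^ (n + cyclotomicExponent p))) * u * u' = -1 → z u = (σ : ℤ_[p]) * z u' := by
    intro u u' h
    have hdvd : ((p ^ (n + cyclotomicExponent p) : ℕ) : ℤ) ∣ (N : ℤ) * u.val * u'.val + 1 := by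
      rw [← ZMod.intCast_zmod_eq_zero_iff_dvd]
      push_cast
      rw [ZMod.natCast_zmod_val, ZMod.natCast_zmod_val, h, neg_add_cancel]
    obtain ⟨A, hA⟩ := hdvd
    have h1 : A * ((p ^ (n + cyclotomicExponent p) : ℕ) : ℤ) - (u.val : ℤ) * (N * (u'.val : ℤ)) =
        1 := by
      linear_combination -hA
    have k1 := ratPlusSymbol_eq_mul_of_normalizedPlusSymbol_eq f hσ
      (hW.normalizedPlusSymbol_div_eq_mul hσ (pow_pos hp.pos _) h1)
    push_cast at k1
    apply PadicInt.ext
    rw [PadicInt.coe_mul, hz u, hz u', k1]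
    push_cast
    ring
  -- the weights in `Λ` and their symmetry
  have hw : ∀ u u' : ZMod (p ^ (n + cyclotomicExponent p)),
      (N : ZMod (p ^ (n + cyclotomicExponent p))) * u * u' = -1 →
        PowerSeries.C (z u) = (σ : IwasawaAlgebra p) * PowerSeries.C (z u') := by
    intro u u' h
    rw [hzsym u u' h, map_mul, map_intCast]
  -- the integral class sum and its image `θ_n`
  set Θ : IwasawaAlgebra p := ∑ᶠ ξ : rootsOfUnity (torsionOrder p) ℤ_[p], ∑ s : ZMod (p ^ n),
    PowerSeries.C (z (PadicInt.toZModPow (n + cyclotomicExponent p) ((ξ : ℤ_[p]ˣ) : ℤ_[p]) *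
      (cyclotomicGenerator p : ZMod (p ^ (n + cyclotomicExponent p))) ^ s.val)) * P ^ s.val
    with hΘ
  have hΘK : iwasawaToPowerSeries p Θ =
      ((((mazurTateElement f p n).map (algebraMap ℚ ℚ_[p])) : Polynomial ℚ_[p]) : ℚ_[p]⟦X⟧) := by
    rw [coe_map_mazurTateElement, hΘ, finsum_eq_sum_of_fintype, finsum_eq_sum_of_fintype, map_sum]
    refine Finset.sum_congr rfl fun ξ _ ↦ ?_
    rw [map_sum]
    refine Finset.sum_congr rfl fun s _ ↦ ?_
    rw [map_mul, map_pow, hP, map_add, map_one, PowerSeries.map_X, PowerSeries.map_C,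
      PadicInt.algebraMap_apply, hz]
  -- `σ² = 1` in `Λ`
  have hσΛ : (σ : IwasawaAlgebra p) * (σ : IwasawaAlgebra p) = 1 := by
    have h := congrArg (Int.cast : ℤ → IwasawaAlgebra p) hσ
    push_cast at h
    rw [← sq]; exact h
  -- reindexing along `u ↦ -1/(Nu)`
  have hre : Θ = (σ : IwasawaAlgebra p) *
      ∑ᶠ ξ : rootsOfUnity (torsionOrder p) ℤ_[p], ∑ s : ZMod (p ^ n),
        PowerSeries.C (z (PadicInt.toZModPow (n + cyclotomicExponent p) ((ξ : ℤ_[p]ˣ) : ℤ_[p]) *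
          (cyclotomicGenerator p : ZMod (p ^ (n + cyclotomicExponent p))) ^ s.val)) *
            P ^ (-sN - s).val :=
    finsum_sum_classes_eq_mul_of_symmetry p n hw hc (fun s ↦ P ^ s.val)
  -- `Θ(T^ι)`
  have hSΘ : Θ.subst (invOnePlusSubOne : ℤ_[p]⟦X⟧) =
      ∑ ξ : rootsOfUnity (torsionOrder p) ℤ_[p], ∑ s : ZMod (p ^ n),
        PowerSeries.C (z (PadicInt.toZModPow (n + cyclotomicExponent p) ((ξ : ℤ_[p]ˣ) : ℤ_[p]) *
          (cyclotomicGenerator p : ZMod (p ^ (n + cyclotomicExponent p))) ^ s.val)) *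
            E ^ s.val := by
    rw [hΘ, finsum_eq_sum_of_fintype, ← coe_substAlgHom hιΛ, map_sum]
    refine Finset.sum_congr rfl fun ξ _ ↦ ?_
    rw [map_sum]
    refine Finset.sum_congr rfl fun s _ ↦ ?_
    rw [map_mul, map_pow, C_eq_algebraMap, AlgHom.commutes, coe_substAlgHom hιΛ, hP,
      subst_invOnePlusSubOne_one_add_X, ← hE]
  -- the exponents `(-sN - s).val + sN.val + s.val` are multiples of `pⁿ`
  have hdiv : ∀ s : ZMod (p ^ n), p ^ n ∣ (-sN - s).val + sN.val + s.val := by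
    intro s
    rw [← ZMod.natCast_eq_zero_iff]
    push_cast
    rw [ZMod.natCast_zmod_val, ZMod.natCast_zmod_val, ZMod.natCast_zmod_val]
    ring
  choose k hk using hdiv
  -- termwise identity
  have hterm : ∀ (zz : ℤ_[p]) (s : ZMod (p ^ n)),
      PowerSeries.C zz * E ^ s.val - P ^ sN.val * (PowerSeries.C zz * P ^ (-sN - s).val) =
        (P ^ p ^ n - 1) * -(PowerSeries.C zz * E ^ s.val *
          ∑ i ∈ Finset.range (k s), (P ^ p ^ n) ^ i) := by
    intro zz s
    have e1 := geom_sum_mul (P ^ p ^ n) (k s)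
    have e2 : P ^ (-sN - s).val * P ^ sN.val * P ^ s.val = (P ^ p ^ n) ^ (k s) := by
      rw [← pow_add, ← pow_add, hk s, pow_mul]
    have e3 : P ^ s.val * E ^ s.val = 1 := one_add_X_pow_mul_E_pow s.val
    linear_combination (PowerSeries.C zz * E ^ s.val) * e1 -
      (PowerSeries.C zz * E ^ s.val) * e2 + (PowerSeries.C zz * P ^ (-sN - s).val * P ^ sN.val) * e3
  -- the identity in `Λ`
  set r : IwasawaAlgebra p := ∑ ξ : rootsOfUnity (torsionOrder p) ℤ_[p], ∑ s : ZMod (p ^ n),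
    -(PowerSeries.C (z (PadicInt.toZModPow (n + cyclotomicExponent p) ((ξ : ℤ_[p]ˣ) : ℤ_[p]) *
        (cyclotomicGenerator p : ZMod (p ^ (n + cyclotomicExponent p))) ^ s.val)) * E ^ s.val *
      ∑ i ∈ Finset.range (k s), (P ^ p ^ n) ^ i) with hr
  refine ⟨Θ, r, hΘK, ?_⟩
  rw [hSΘ, coe_map_cyclotomicOmega, ← hP]
  conv_lhs => rw [hre]
  rw [finsum_eq_sum_of_fintype]
  set S2 := ∑ ξ : rootsOfUnity (torsionOrder p) ℤ_[p], ∑ s : ZMod (p ^ n),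
    PowerSeries.C (z (PadicInt.toZModPow (n + cyclotomicExponent p) ((ξ : ℤ_[p]ˣ) : ℤ_[p]) *
      (cyclotomicGenerator p : ZMod (p ^ (n + cyclotomicExponent p))) ^ s.val)) *
        P ^ (-sN - s).val with hS2
  have hσσ : (σ : IwasawaAlgebra p) * P ^ sN.val * ((σ : IwasawaAlgebra p) * S2) =
      P ^ sN.val * S2 := by
    linear_combination (P ^ sN.val * S2) * hσΛ
  rw [hσσ, hS2, hr, Finset.mul_sum, Finset.mul_sum, ← Finset.sum_sub_distrib]
  refine Finset.sum_congr rfl fun ξ _ ↦ ?_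
  rw [Finset.mul_sum, Finset.mul_sum, ← Finset.sum_sub_distrib]
  refine Finset.sum_congr rfl fun s _ ↦ ?_
  exact hterm _ s

end FiniteLevel


end Literature.NumberTheory.EllipticCurves

end
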